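import Summits.QuantumFields.YangMills.Theorems.PoincareLipschitzSphereMapHarmonicExtensionNearSphere
import Summits.QuantumFields.YangMills.Theorems.PoincareLipschitzSphereMapBoxAverageLetters
import Summits.QuantumFields.YangMills.Theorems.PoincareLipschitzSphereMapPoincareL1
import Literature.MathematicalPhysics.QuantumFieldTheory.Balaban1983to89.B4Eq19LatticeBoxMeans

/-!
# Line «poincare_lipschitz» on crux `HistoryTailL` (stmt-QuantumFields-19936), route crux `BlockLipschitzL` (stmt-QuantumFields-23533), K2 organ of record LOC-REG-MIN —
# FLAT SHADOW «ENERGY → RANGE» (E→R) FOR LATTICE MINIMISERS INTO A SPHERE, FILE 5d-C: THE HARMONIC EXTENSION OF THE MOLLIFIED RING DATA STAYS NEAR THE SPHERE —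
# vector lattice paths, the fixed-radius mollifier is `√((2s+1)^{−d}·E)`-Lipschitz per bond, its oscillation over `Q_R` is `≤ 2dR·√((2s+1)^{−d}E)`, and (F1 with `B = 0`)
# `‖H x‖ ≥ 1 − (2dR·√((2s+1)^{−d}·E(u;Q_{R+s})) + 2(2s+1)·√(d·(2s+1)^{−d}·E(u;Q_{R+s})))` on `Q_R(z)` — the `m` of ✓`interior_comparison`

Cell `ym3-torus` (YM ladder rung R3 = continuum SU(2) Yang–Mills on the three-torus — a RUNG, NOT the Clay problem: not d = 4, not infinite volume, not a mass gap); width seat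
`ym-ust-19936-w5` gen 12 (LEAD ym-ust-19936-w1 g8 2026-08-29T05:29:02Z END-GAME «[C] = E→R F5 (★w5) + F6 (px8)»; my LOCATE `E2R-ROAD-w5g12.md` §2 (v)).  THEOREMS ONLY
(def-free; the fixed-radius mollifier is written `(#Q_s(y))⁻¹ • Σ_{Q_s(y)} u`), values in any real inner-product space `V`, lattice letters of lit ✓`B4Eq19LatticeOperators` ∕
✓`B4Eq19LatticeBoxMeans` (`pathPt`); composes ★w5 g12's ✓F1 (`norm_ge_of_vecHarmonic`), ✓F2a (`normSq_boxMean_shift_sub_le`, `norm_mean_le_one`), ✓F2b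
(`one_sub_norm_boxMean_le_sqrt`); `--supports stmt-QuantumFields-19936`.  Nothing here proves E→R, LOC-REG-MIN, `hReg`, `hImprove`, a stub, `BlockLipschitzL`, `HistoryTailL`
or a summit statement.
* §1 `norm_sub_update_le`, `norm_sub_update_le'`, ★ `norm_sub_le_of_bond_bound` — VECTOR LATTICE PATHS (port of lit ✓`abs_sub_le_of_fdiff_bound`): a per-bond bound `S` on
  `Q_ρ(x)` gives `‖v y − v x‖ ≤ d·ρ·S` for `y ∈ Q_ρ(x)`.
* §2 ★ `norm_boxMean_shift_sub_le_sqrt` — the fixed-radius mollifier is `√((2s+1)^{−d}·E(u; W))`-Lipschitz per bond wherever `Q_s ⊆ W`; ★ `norm_boxMean_sub_boxMean_le_osc` — its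
  oscillation over `Q_R(z)`: `‖ū_s(y) − ū_s(y′)‖ ≤ 2dR·√((2s+1)^{−d}·E(u; Q_{R+s+1}(z)))`.
* §3 ★★★ `norm_harmonicExt_ge_of_ring` — `u` unit-valued, `H` componentwise harmonic on `Q_{R−1}(z)` and equal to the radius-`s` mollifier of `u` on the ring `Q_R(z) ∖ Q_{R−1}(z)`
  (`R ≥ 1`, `s ≥ 0`, `d ≥ 1`) ⟹ for every `x ∈ Q_R(z)`:
  `‖H x‖ ≥ 1 − (2dR·√((2s+1)^{−d}·E(u;Q_{R+s+1}(z))) + 2(2s+1)·√(d·(2s+1)^{−d}·E(u;Q_{R+s+1}(z))))`.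
[folklore] ([SchoenUhlenbeck1982] §4 (the harmonic extension of the mollified trace stays near `N`); [Giaquinta1984] Ch. III §1 p.70 (lattice paths); the lattice statements are
this file's).
-/

set_option autoImplicit false

noncomputable section

open scoped BigOperators InnerProductSpace
open Finset

namespace Summit.QuantumFields.YangMills.Theorems.PoincareLipschitzSphereMapRingNearSphere

open Literature.MathematicalPhysics.QuantumFieldTheory.Balaban1983to89
open B4Eq19LatticeOperators
open B4Eq19LatticeBoxMeans (pathPt pathPt_zero pathPt_self pathPt_succ update_pathPt_mem_box update_succ_eq_add_unitVec)
open Summit.QuantumFields.YangMills.Theorems.PoincareLipschitzSphereMapHarmonicExtensionNearSphere (norm_ge_of_vecHarmonic)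
open Summit.QuantumFields.YangMills.Theorems.PoincareLipschitzSphereMapBoxAverageLetters (normSq_boxMean_shift_sub_le norm_mean_le_one)
open Summit.QuantumFields.YangMills.Theorems.PoincareLipschitzSphereMapPoincareL1 (one_sub_norm_boxMean_le_sqrt)

variable {d : ℕ} {V : Type*} [NormedAddCommGroup V] [InnerProductSpace ℝ V]

/-! ## §1 Vector lattice paths -/

omit [InnerProductSpace ℝ V] in
/-- ONE COORDINATE: if `update q j t ∈ Q_ρ(x)` for `a ≤ t ≤ a + n` and the forward differences of `v` are `≤ S` in norm on `Q_ρ(x)`, then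
`‖v(update q j (a+n)) − v(update q j a)‖ ≤ n·S`. [folklore] (port of lit ✓`abs_sub_update_le`) [cite: Giaquinta1984, Ch. III §1 p.70] -/
theorem norm_sub_update_le (v : Zd d → V) {x : Zd d} {ρ : ℤ} {S : ℝ} (hS : ∀ y ∈ box x ρ, ∀ ν : Fin d, ‖v (y + unitVec ν) - v y‖ ≤ S)
    (q : Zd d) (j : Fin d) (a : ℤ) :
    ∀ n : ℕ, (∀ t : ℤ, a ≤ t → t ≤ a + n → Function.update q j t ∈ box x ρ) →
      ‖v (Function.update q j (a + n)) - v (Function.update q j a)‖ ≤ n * S := by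
  intro n
  induction n with
  | zero => intro _; simp
  | succ n ih =>
    intro hmem
    have ih' := ih fun t h1 h2 => hmem t h1 (by push_cast; linarith)
    have hin : Function.update q j (a + n) ∈ box x ρ := hmem (a + n) (by linarith) (by push_cast; linarith)
    have e : Function.update q j (a + ((n + 1 : ℕ) : ℤ)) = Function.update q j (a + n) + unitVec j := by
      rw [← update_succ_eq_add_unitVec]; push_cast; ring_nf
    have hstep : ‖v (Function.update q j (a + ((n + 1 : ℕ) : ℤ))) - v (Function.update q j (a + n))‖ ≤ S := by
      rw [e]; exact hS _ hin j
    calc ‖v (Function.update q j (a + ((n + 1 : ℕ) : ℤ))) - v (Function.update q j a)‖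
        = ‖(v (Function.update q j (a + ((n + 1 : ℕ) : ℤ))) - v (Function.update q j (a + n))) +
            (v (Function.update q j (a + n)) - v (Function.update q j a))‖ := by congr 1; abel
      _ ≤ S + n * S := (norm_add_le _ _).trans (add_le_add hstep ih')
      _ = ((n + 1 : ℕ) : ℝ) * S := by push_cast; ring

omit [InnerProductSpace ℝ V] in
/-- ONE COORDINATE, both orientations: `‖v(update q j s′) − v(update q j s)‖ ≤ |s′ − s|·S` if the segment stays in `Q_ρ(x)`. [folklore]
(port of lit ✓`abs_sub_update_le'`) [cite: Giaquinta1984, Ch. III §1 p.70] -/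
theorem norm_sub_update_le' (v : Zd d → V) {x : Zd d} {ρ : ℤ} {S : ℝ} (hS : ∀ y ∈ box x ρ, ∀ ν : Fin d, ‖v (y + unitVec ν) - v y‖ ≤ S)
    (q : Zd d) (j : Fin d) {s s' : ℤ} (hseg : ∀ t : ℤ, min s s' ≤ t → t ≤ max s s' → Function.update q j t ∈ box x ρ) :
    ‖v (Function.update q j s') - v (Function.update q j s)‖ ≤ |((s' : ℤ) : ℝ) - s| * S := by
  rcases le_total s s' with h | h
  · obtain ⟨n, hn⟩ : ∃ n : ℕ, s' = s + n := ⟨(s' - s).toNat, by rw [Int.toNat_of_nonneg (by linarith)]; ring⟩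
    have key := norm_sub_update_le v hS q j s n fun t h1 h2 =>
      hseg t (by rw [min_eq_left h]; exact h1) (by rw [max_eq_right h, hn]; exact h2)
    rw [← hn] at key
    have habs : |((s' : ℤ) : ℝ) - s| = n := by
      rw [hn]; push_cast; rw [show (s : ℝ) + n - s = n by ring, Nat.abs_cast]
    rwa [habs]
  · obtain ⟨n, hn⟩ : ∃ n : ℕ, s = s' + n := ⟨(s - s').toNat, by rw [Int.toNat_of_nonneg (by linarith)]; ring⟩
    have key := norm_sub_update_le v hS q j s' n fun t h1 h2 =>
      hseg t (by rw [min_eq_right h]; exact h1) (by rw [max_eq_left h, hn]; exact h2)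
    rw [← hn, norm_sub_rev] at key
    have habs : |((s' : ℤ) : ℝ) - s| = n := by
      rw [hn]; push_cast; rw [show (s' : ℝ) - (s' + n) = -(n : ℝ) by ring, abs_neg, Nat.abs_cast]
    rwa [habs]

omit [InnerProductSpace ℝ V] in
/-- ★ **VECTOR LATTICE PATHS**: a per-bond bound `‖v(y+e_ν) − v y‖ ≤ S` on `Q_ρ(x)` gives `‖v y − v x‖ ≤ d·ρ·S` for every `y ∈ Q_ρ(x)`. [folklore]
(port of lit ✓`abs_sub_le_of_fdiff_bound`) [cite: Giaquinta1984, Ch. III §1 p.70] -/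
theorem norm_sub_le_of_bond_bound (v : Zd d → V) {x : Zd d} {ρ : ℤ} {S : ℝ} (hS0 : 0 ≤ S)
    (hS : ∀ y ∈ box x ρ, ∀ ν : Fin d, ‖v (y + unitVec ν) - v y‖ ≤ S) {y : Zd d} (hy : y ∈ box x ρ) : ‖v y - v x‖ ≤ d * ρ * S := by
  have hyi := mem_box.1 hy
  have main : ∀ k : ℕ, k ≤ d → ‖v (pathPt x y k) - v x‖ ≤ k * ρ * S := by
    intro k
    induction k with
    | zero => intro _; rw [pathPt_zero, sub_self, norm_zero]; simp
    | succ k ih =>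
      intro hk
      have hk' : k < d := by omega
      set kk : Fin d := ⟨k, hk'⟩
      obtain ⟨e1, e2⟩ := pathPt_succ x y kk
      have hstep : ‖v (pathPt x y (k + 1)) - v (pathPt x y k)‖ ≤ ρ * S := by
        have h := norm_sub_update_le' v hS (pathPt x y k) kk (s := x kk) (s' := y kk)
          fun t h1 h2 => update_pathPt_mem_box hy kk h1 h2
        rw [← e1, ← e2] at h
        refine h.trans (mul_le_mul_of_nonneg_right ?_ hS0)
        have := hyi kk
        have : (((|y kk - x kk| : ℤ)) : ℝ) ≤ ρ := by exact_mod_cast this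
        rwa [Int.cast_abs, Int.cast_sub] at this
      calc ‖v (pathPt x y (k + 1)) - v x‖ = ‖(v (pathPt x y (k + 1)) - v (pathPt x y k)) + (v (pathPt x y k) - v x)‖ := by congr 1; abel
        _ ≤ ρ * S + k * ρ * S := (norm_add_le _ _).trans (add_le_add hstep (ih hk'.le))
        _ = ((k + 1 : ℕ) : ℝ) * ρ * S := by push_cast; ring
  have := main d le_rfl
  rwa [pathPt_self] at this

/-! ## §2 The fixed-radius mollifier: per-bond Lipschitz from the energy, oscillation over a box -/

/-- ★ **PER-BOND LIPSCHITZ OF THE FIXED-RADIUS MOLLIFIER**: `s ≥ 0`, `Q_s(y) ⊆ W` ⟹ `‖ū_s(y+e_ν) − ū_s(y)‖ ≤ √(((2s+1)^d)⁻¹ · E(u; W))`,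
`E(u;W) = Σ_{w∈W}Σ_μ‖u(w+e_μ) − u w‖²`. [folklore] -/
theorem norm_boxMean_shift_sub_le_sqrt (u : Zd d → V) (y : Zd d) {s : ℤ} (hs : 0 ≤ s) (ν : Fin d) (W : Finset (Zd d)) (hW : box y s ⊆ W) :
    ‖(((box (y + unitVec ν) s).card : ℝ))⁻¹ • ∑ w ∈ box (y + unitVec ν) s, u w - (((box y s).card : ℝ))⁻¹ • ∑ w ∈ box y s, u w‖ ≤
      Real.sqrt (((((2 * s + 1 : ℤ) : ℝ) ^ d))⁻¹ * ∑ w ∈ W, ∑ μ, ‖u (w + unitVec μ) - u w‖ ^ 2) := by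
  have h1' := normSq_boxMean_shift_sub_le u y hs ν
  have hc' : (((box y s).card : ℝ))⁻¹ = ((((2 * s + 1 : ℤ) : ℝ) ^ d))⁻¹ := by rw [card_box y hs]
  have h1 : ‖(((box (y + unitVec ν) s).card : ℝ))⁻¹ • ∑ w ∈ box (y + unitVec ν) s, u w - (((box y s).card : ℝ))⁻¹ • ∑ w ∈ box y s, u w‖ ^ 2 ≤
      ((((2 * s + 1 : ℤ) : ℝ) ^ d))⁻¹ * ∑ w ∈ box y s, ‖u (w + unitVec ν) - u w‖ ^ 2 := by
    calc _ ≤ _ := h1'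
      _ = _ := by rw [hc']
  have h2 : ∑ w ∈ box y s, ‖u (w + unitVec ν) - u w‖ ^ 2 ≤ ∑ w ∈ W, ∑ μ, ‖u (w + unitVec μ) - u w‖ ^ 2 :=
    (Finset.sum_le_sum fun w _ => Finset.single_le_sum (f := fun μ => ‖u (w + unitVec μ) - u w‖ ^ 2) (fun _ _ => by positivity) (Finset.mem_univ ν)).trans
      (Finset.sum_le_sum_of_subset_of_nonneg hW fun _ _ _ => Finset.sum_nonneg fun _ _ => by positivity)
  have hc : 0 ≤ ((((2 * s + 1 : ℤ) : ℝ) ^ d))⁻¹ := by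
    have : (0 : ℝ) < ((2 * s + 1 : ℤ) : ℝ) := by exact_mod_cast (show (0 : ℤ) < 2 * s + 1 by linarith)
    positivity
  have h3 := h1.trans (mul_le_mul_of_nonneg_left h2 hc)
  have hP : 0 ≤ ‖(((box (y + unitVec ν) s).card : ℝ))⁻¹ • ∑ w ∈ box (y + unitVec ν) s, u w - (((box y s).card : ℝ))⁻¹ • ∑ w ∈ box y s, u w‖ :=
    norm_nonneg _
  rw [← Real.sqrt_sq hP]
  exact Real.sqrt_le_sqrt h3

/-- ★ **OSCILLATION OF THE FIXED-RADIUS MOLLIFIER OVER `Q_R(z)`**: `s ≥ 0` ⟹ for `y, y′ ∈ Q_R(z)`: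
`‖ū_s(y) − ū_s(y′)‖ ≤ 2·d·R·√(((2s+1)^d)⁻¹ · E(u; Q_{R+s+1}(z)))` (vector lattice paths through the centre). [folklore] -/
theorem norm_boxMean_sub_boxMean_le_osc (u : Zd d → V) (z : Zd d) {R s : ℤ} (hs : 0 ≤ s) {y y' : Zd d} (hy : y ∈ box z R) (hy' : y' ∈ box z R) :
    ‖(((box y s).card : ℝ))⁻¹ • ∑ w ∈ box y s, u w - (((box y' s).card : ℝ))⁻¹ • ∑ w ∈ box y' s, u w‖ ≤
      2 * d * R * Real.sqrt (((((2 * s + 1 : ℤ) : ℝ) ^ d))⁻¹ * ∑ w ∈ box z (R + s + 1), ∑ μ, ‖u (w + unitVec μ) - u w‖ ^ 2) := by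
  set S : ℝ := Real.sqrt (((((2 * s + 1 : ℤ) : ℝ) ^ d))⁻¹ * ∑ w ∈ box z (R + s + 1), ∑ μ, ‖u (w + unitVec μ) - u w‖ ^ 2) with hSdef
  set v : Zd d → V := fun p => (((box p s).card : ℝ))⁻¹ • ∑ w ∈ box p s, u w with hv
  have hS0 : 0 ≤ S := Real.sqrt_nonneg _
  have hbond : ∀ p ∈ box z R, ∀ ν : Fin d, ‖v (p + unitVec ν) - v p‖ ≤ S := by
    intro p hp ν
    have hsub : box p s ⊆ box z (R + s + 1) := by
      refine box_subset_box fun i => ?_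
      have := (mem_box.1 hp) i; linarith
    exact norm_boxMean_shift_sub_le_sqrt u p hs ν _ hsub
  have h1 := norm_sub_le_of_bond_bound v hS0 hbond hy
  have h2 := norm_sub_le_of_bond_bound v hS0 hbond hy'
  calc ‖v y - v y'‖ = ‖(v y - v z) - (v y' - v z)‖ := by congr 1; abel
    _ ≤ ‖v y - v z‖ + ‖v y' - v z‖ := norm_sub_le _ _
    _ ≤ d * R * S + d * R * S := add_le_add h1 h2
    _ = 2 * d * R * S := by ring

/-! ## §3 The harmonic extension of the mollified ring data stays near the sphere -/

/-- ★★★ **`m` FOR THE INTERIOR COMPARISON.**  `d ≥ 1`, `R ≥ 1`, `s ≥ 0`; `u` unit-valued on `Q_{R+s}(z)`; `H` componentwise harmonic on `Q_{R−1}(z)` and EQUAL TO THE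
RADIUS-`s` MOLLIFIER `ū_s` of `u` on the ring `Q_R(z) ∖ Q_{R−1}(z)`.  THEN for every `x ∈ Q_R(z)`, with `E := E(u; Q_{R+s+1}(z))`:
`‖H x‖ ≥ 1 − (2dR·√(((2s+1)^d)⁻¹·E) + 2(2s+1)·√(d·((2s+1)^d)⁻¹·E))` — oscillation of the ring data (§2) plus its near-sphere defect at one ring point
(✓`one_sub_norm_boxMean_le_sqrt`), fed to F1 ✓`norm_ge_of_vecHarmonic` with `B = 0`. [folklore] [cite: SchoenUhlenbeck1982, §4] -/
theorem norm_harmonicExt_ge_of_ring (hd : 0 < d) (u H : Zd d → V) (z : Zd d) {R s : ℤ} (hR : 1 ≤ R) (hs : 0 ≤ s)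
    (hu : ∀ y ∈ box z (R + s), ‖u y‖ = 1)
    (hH : ∀ y ∈ box z (R - 1), ∑ μ, ((H y + H y) - H (y - unitVec μ) - H (y + unitVec μ)) = 0)
    (hring : ∀ y ∈ box z R, y ∉ box z (R - 1) → H y = (((box y s).card : ℝ))⁻¹ • ∑ w ∈ box y s, u w) {x : Zd d} (hx : x ∈ box z R) :
    1 - (2 * d * R * Real.sqrt (((((2 * s + 1 : ℤ) : ℝ) ^ d))⁻¹ * ∑ w ∈ box z (R + s + 1), ∑ μ, ‖u (w + unitVec μ) - u w‖ ^ 2) +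
        2 * ((2 * s + 1 : ℤ) : ℝ) * Real.sqrt (d * ((((2 * s + 1 : ℤ) : ℝ) ^ d))⁻¹ * ∑ w ∈ box z (R + s + 1), ∑ μ, ‖u (w + unitVec μ) - u w‖ ^ 2)) ≤ ‖H x‖ := by
  set E : ℝ := ∑ w ∈ box z (R + s + 1), ∑ μ, ‖u (w + unitVec μ) - u w‖ ^ 2 with hE
  set osc : ℝ := 2 * d * R * Real.sqrt (((((2 * s + 1 : ℤ) : ℝ) ^ d))⁻¹ * E) with hosc
  set η₀ : ℝ := 2 * ((2 * s + 1 : ℤ) : ℝ) * Real.sqrt (d * ((((2 * s + 1 : ℤ) : ℝ) ^ d))⁻¹ * E) with hη₀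
  -- a ring point
  set y₁ : Zd d := z + R • unitVec ⟨0, hd⟩ with hy₁
  have hy₁R : y₁ ∈ box z R := by
    rw [mem_box]; intro i
    by_cases hi : i = ⟨0, hd⟩
    · subst hi; simp [hy₁, unitVec, abs_of_nonneg (show (0:ℤ) ≤ R by linarith)]
    · simp [hy₁, unitVec, Pi.single_eq_of_ne hi]; linarith
  have hy₁R' : y₁ ∉ box z (R - 1) := by
    intro h; have := (mem_box.1 h) ⟨0, hd⟩; simp [hy₁, unitVec] at this
    rw [abs_of_nonneg (by linarith)] at this; linarith
  -- the mollifier at `y₁`: near the sphere (F2b) and of norm ≤ 1 (F2a)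
  set v : Zd d → V := fun p => (((box p s).card : ℝ))⁻¹ • ∑ w ∈ box p s, u w with hv
  have hsub1 : box y₁ s ⊆ box z (R + s) := by
    refine box_subset_box fun i => ?_; have := (mem_box.1 hy₁R) i; linarith
  have hu1 : ∀ w ∈ box y₁ s, ‖u w‖ = 1 := fun w hw => hu w (hsub1 hw)
  have hne1 : (box y₁ s).Nonempty := ⟨y₁, self_mem_box y₁ hs⟩
  have hdef := one_sub_norm_boxMean_le_sqrt u y₁ hs hu1
  have hE1 : ∑ w ∈ box y₁ s, ∑ μ, ‖u (w + unitVec μ) - u w‖ ^ 2 ≤ E :=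
    Finset.sum_le_sum_of_subset_of_nonneg (hsub1.trans (box_mono z (by linarith))) fun _ _ _ => Finset.sum_nonneg fun _ _ => by positivity
  have hc1 : (((box y₁ s).card : ℝ))⁻¹ = ((((2 * s + 1 : ℤ) : ℝ) ^ d))⁻¹ := by rw [card_box y₁ hs]
  have hdef' : 1 - ‖v y₁‖ ≤ 2 * ((2 * s + 1 : ℤ) : ℝ) * Real.sqrt (d * ((((2 * s + 1 : ℤ) : ℝ) ^ d))⁻¹ * ∑ w ∈ box y₁ s, ∑ μ, ‖u (w + unitVec μ) - u w‖ ^ 2) := by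
    calc _ ≤ _ := hdef
      _ = _ := by rw [hc1]
  have hη : 1 - ‖v y₁‖ ≤ η₀ := by
    have hpos : (0 : ℝ) < ((2 * s + 1 : ℤ) : ℝ) := by exact_mod_cast (show (0 : ℤ) < 2 * s + 1 by linarith)
    have hc : 0 ≤ (d : ℝ) * ((((2 * s + 1 : ℤ) : ℝ) ^ d))⁻¹ := by positivity
    have h2 : Real.sqrt (d * ((((2 * s + 1 : ℤ) : ℝ) ^ d))⁻¹ * ∑ w ∈ box y₁ s, ∑ μ, ‖u (w + unitVec μ) - u w‖ ^ 2) ≤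
        Real.sqrt (d * ((((2 * s + 1 : ℤ) : ℝ) ^ d))⁻¹ * E) := Real.sqrt_le_sqrt (mul_le_mul_of_nonneg_left hE1 hc)
    have := mul_le_mul_of_nonneg_left h2 (by positivity : (0 : ℝ) ≤ 2 * ((2 * s + 1 : ℤ) : ℝ))
    exact hdef'.trans this
  have hv1 : ‖v y₁‖ ≤ 1 := norm_mean_le_one (box y₁ s) hne1 u hu1
  have hvpos : 0 < ‖v y₁‖ ∨ ‖v y₁‖ = 0 := by rcases (norm_nonneg (v y₁)).lt_or_eq with h | h; exact Or.inl h; exact Or.inr h.symm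
  -- the unit vector `c₀` and the layer bound `‖H y − c₀‖ ≤ osc + η₀`
  have hoscb : ∀ y ∈ box z R, ‖v y - v y₁‖ ≤ osc := fun y hy => norm_boxMean_sub_boxMean_le_osc u z hs hy hy₁R
  -- choose `c₀ := ‖v y₁‖⁻¹ • v y₁` if `v y₁ ≠ 0`; if `v y₁ = 0` then `η₀ ≥ 1` and the claim is trivial
  by_cases hv0 : v y₁ = 0
  · have : 1 ≤ η₀ := by rw [hv0, norm_zero, sub_zero] at hη; exact hη
    have hosc0 : 0 ≤ osc := by positivity
    linarith [norm_nonneg (H x)]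
  · set c₀ : V := (‖v y₁‖)⁻¹ • v y₁ with hc₀
    have hnv : 0 < ‖v y₁‖ := norm_pos_iff.2 hv0
    have hc₀1 : ‖c₀‖ = 1 := by rw [hc₀, norm_smul, Real.norm_eq_abs, abs_of_pos (inv_pos.2 hnv), inv_mul_cancel₀ hnv.ne']
    have hvc₀ : ‖v y₁ - c₀‖ = 1 - ‖v y₁‖ := by
      have e : v y₁ - c₀ = (1 - (‖v y₁‖)⁻¹) • v y₁ := by rw [hc₀, sub_smul, one_smul]
      rw [e, norm_smul, Real.norm_eq_abs]
      have h1 : (‖v y₁‖)⁻¹ ≥ 1 := one_le_inv_iff₀.2 ⟨hnv, hv1⟩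
      rw [abs_of_nonpos (by linarith), neg_sub, sub_mul, inv_mul_cancel₀ hnv.ne', one_mul]
    have hlayer : ∀ y ∈ box z ((R - 1) + 1), y ∉ box z (R - 1) → ‖H y - c₀‖ ^ 2 ≤ (osc + η₀) ^ 2 + 0 * ∑ i, ((y i - x i : ℤ) : ℝ) ^ 2 := by
      intro y hy hyr
      rw [sub_add_cancel] at hy
      rw [zero_mul, add_zero, hring y hy hyr]
      have h1 : ‖v y - c₀‖ ≤ osc + η₀ := by
        calc ‖v y - c₀‖ = ‖(v y - v y₁) + (v y₁ - c₀)‖ := by congr 1; abel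
          _ ≤ ‖v y - v y₁‖ + ‖v y₁ - c₀‖ := norm_add_le _ _
          _ ≤ osc + η₀ := by rw [hvc₀]; exact add_le_add (hoscb y hy) hη
      have h0 : 0 ≤ ‖v y - c₀‖ := norm_nonneg _
      exact pow_le_pow_left₀ h0 h1 2
    have hx' : x ∈ box z ((R - 1) + 1) := by rw [sub_add_cancel]; exact hx
    have hmain := norm_ge_of_vecHarmonic hd H c₀ hc₀1 z x (r := R - 1) (by linarith) hx' ⟨0, hd⟩ (le_refl (0 : ℝ)) hH hlayer
    rw [zero_mul, zero_mul, add_zero] at hmain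
    have hsq : Real.sqrt ((osc + η₀) ^ 2) = osc + η₀ := Real.sqrt_sq (by positivity)
    rw [hsq] at hmain
    exact hmain

end Summit.QuantumFields.YangMills.Theorems.PoincareLipschitzSphereMapRingNearSphere
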